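import Summits.ValiantsHypothesis.ValiantsHypothesis.Theorems.KPlusLogSqLawDefinitePivotZone

/-!
# Route «KPlusLogSqLaw», crux `WeakLifting` (stmt-ValiantsHypothesis-19561) — α register / Lift line:
# past a pivot-dominated point, PSD-domination is PERMANENT (the positive zone is a pair of rays)

HONEST FRAMING.  Helper file (`--supports stmt-ValiantsHypothesis-19561 --as helper`), seat val-sym-lift-p2 (g12), cell `pub-symmetroid`,
2026-08-28; companion of `…KPlusLogSqLawDefinitePivotZone` (p602968: the negative-definite zone is an interval).  Elementary convexity;
nothing here bounds a root count; nothing bears on `WeakLifting`, `TropicalB`, Conjecture B, Door-A, `MatrixDescartes` (18050) or VP ≠ VNP.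

WHAT IS PROVED.  `Pₖ ⪰ 0` with exponents `dₖ`, `N` any real symmetric letter with exponent `e`, `F(x) = ∑ₖ x^{dₖ}Pₖ − x^e N`.
* `posDef_pencil_of_negDef_left` — if `F(x₀) ≺ 0` and `F(a) ≻ 0` for some `0 < x₀ ≤ a`, then `F(b) ≻ 0` for EVERY `b ≥ a`;
* `posDef_pencil_of_negDef_right` — mirror: `F(x₀) ≺ 0`, `F(a) ≻ 0`, `0 < b ≤ a ≤ x₀` ⇒ `F(b) ≻ 0`.
So once the pencil is negative definite somewhere (`x₀`), the set `{x > 0 : F(x) ≻ 0}` meets `(x₀, ∞)` in an up-ray and `(0, x₀)` in a down-ray: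
together with the interval lemma for `{F ≺ 0}` the two EXTREME eigenvalue sheets of such a pencil carry at most four zeros of `det F`
(two boundary points of the interval, one endpoint of each ray) — for every size `m` and every number of letters.  Mechanism: for a test vector
`u`, `g_u(x) = ∑ₖ x^{dₖ−e}(uᵀPₖu)` is convex on `(0,∞)` (integer powers); `g_u(x₀) < uᵀNu < g_u(a)` with `x₀ < a < b` and `g_u(b) ≤ uᵀNu` would put the
value at the interior point `a` above both endpoint values.  In the lineage's frame `det(E(t) − A)` (rank unfolding, p602364) this is the statement that
after the pivot-dominated era the count of eigenvalues of `P(t) = ∑ e^{μᵢt}vᵢvᵢᵀ` below `1`, once zero, stays zero.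

[folklore] Convexity of `x ↦ x^q` (`q ∈ ℤ`) on `(0, ∞)`.
-/

-- `Summit.ValiantsHypothesis.ValiantsHypothesis.…` repeats a component by the D-0017 layout
-- (single-conjunct summit), which the `dupNamespace` linter flags; the name is mandated.
set_option linter.dupNamespace false
set_option autoImplicit false

namespace Summit.ValiantsHypothesis.ValiantsHypothesis.Theorems.KPlusLogSqLaw.DefinitePivot

open Matrix Finset
open scoped BigOperators

variable {m K : ℕ}

/-- the quadratic form of `∑ₖ x^{dₖ} Pₖ − x^e N` at a real vector. [folklore] -/
theorem dotProduct_pencilSub_mulVec (P : Fin K → Matrix (Fin m) (Fin m) ℝ) (N : Matrix (Fin m) (Fin m) ℝ)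
    (d : Fin K → ℕ) (e : ℕ) (x : ℝ) (u : Fin m → ℝ) :
    u ⬝ᵥ ((∑ k, x ^ d k • P k - x ^ e • N) *ᵥ u) =
      ∑ k, x ^ d k * (u ⬝ᵥ (P k *ᵥ u)) - x ^ e * (u ⬝ᵥ (N *ᵥ u)) := by
  rw [← neg_sub, Matrix.neg_mulVec, dotProduct_neg, dotProduct_pivotSub_mulVec, neg_sub]

/-- convexity step: a convex combination of Laurent monomial sums. For `0 < x₀ < b`, `a = λ x₀ + μ b` (`λ, μ ≥ 0`, `λ + μ = 1`) and
non-negative weights `bₖ`: `∑ₖ a^{qₖ} bₖ ≤ λ ∑ₖ x₀^{qₖ} bₖ + μ ∑ₖ b^{qₖ} bₖ`. [folklore] -/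
theorem sum_zpow_mul_le_convex_comb (q : Fin K → ℤ) (w : Fin K → ℝ) (hw : ∀ k, 0 ≤ w k) {x₀ b lam mu : ℝ}
    (hx₀ : 0 < x₀) (hb : 0 < b) (hlam : 0 ≤ lam) (hmu : 0 ≤ mu) (hsum : lam + mu = 1) :
    ∑ k, (lam • x₀ + mu • b) ^ q k * w k ≤ lam * ∑ k, x₀ ^ q k * w k + mu * ∑ k, b ^ q k * w k := by
  calc ∑ k, (lam • x₀ + mu • b) ^ q k * w k
      ≤ ∑ k, (lam * x₀ ^ q k + mu * b ^ q k) * w k := by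
        refine Finset.sum_le_sum fun k _ => mul_le_mul_of_nonneg_right ?_ (hw k)
        have h := (convexOn_zpow (q k)).2 (Set.mem_Ioi.2 hx₀) (Set.mem_Ioi.2 hb) hlam hmu hsum
        simpa only [smul_eq_mul] using h
    _ = lam * ∑ k, x₀ ^ q k * w k + mu * ∑ k, b ^ q k * w k := by
        rw [Finset.mul_sum, Finset.mul_sum, ← Finset.sum_add_distrib]
        refine Finset.sum_congr rfl fun k _ => ?_
        ring

/-- **PSD-DOMINATION IS PERMANENT PAST A PIVOT-DOMINATED POINT (rightward).**  `Pₖ ⪰ 0`, `N` symmetric, `0 < x₀ ≤ a ≤ b`: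
`x₀^e N − ∑ x₀^{dₖ}Pₖ ≻ 0` and `∑ a^{dₖ}Pₖ − a^e N ≻ 0` imply `∑ b^{dₖ}Pₖ − b^e N ≻ 0`. [folklore] -/
theorem posDef_pencil_of_negDef_left (P : Fin K → Matrix (Fin m) (Fin m) ℝ) (hP : ∀ k, (P k).PosSemidef)
    (N : Matrix (Fin m) (Fin m) ℝ) (hN : N.IsSymm) (d : Fin K → ℕ) (e : ℕ) {x₀ a b : ℝ}
    (hx₀ : 0 < x₀) (h₀a : x₀ ≤ a) (hab : a ≤ b)
    (hneg : (x₀ ^ e • N - ∑ k, x₀ ^ d k • P k).PosDef) (hFa : (∑ k, a ^ d k • P k - a ^ e • N).PosDef) :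
    (∑ k, b ^ d k • P k - b ^ e • N).PosDef := by
  have ha : 0 < a := lt_of_lt_of_le hx₀ h₀a
  have hb : 0 < b := lt_of_lt_of_le ha hab
  have hherm : (∑ k, b ^ d k • P k - b ^ e • N).IsHermitian := by
    have h := isHermitian_pivotSub P (fun k => (hP k).1) N hN d e b
    rw [← neg_sub]
    exact h.neg
  refine PosDef.of_dotProduct_mulVec_pos hherm fun u hu => ?_
  have h0q := hneg.dotProduct_mulVec_pos hu
  have haq := hFa.dotProduct_mulVec_pos hu
  rw [star_trivial] at h0q haq ⊢
  rw [dotProduct_pivotSub_mulVec] at h0q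
  rw [dotProduct_pencilSub_mulVec] at haq ⊢
  set c : ℝ := u ⬝ᵥ (N *ᵥ u) with hc
  set w : Fin K → ℝ := fun k => u ⬝ᵥ (P k *ᵥ u) with hw
  have hw0 : ∀ k, 0 ≤ w k := fun k => by
    have h := (hP k).dotProduct_mulVec_nonneg u
    rwa [star_trivial] at h
  -- g(s) = ∑ s^{dₖ−e} wₖ ;  g(x₀) < c < g(a) ; want c < g(b)
  have hg : ∀ s : ℝ, 0 < s → ∀ r : ℝ, (∑ k, s ^ d k * w k - s ^ e * r = s ^ e * (∑ k, s ^ ((d k : ℤ) - e) * w k - r)) := by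
    intro s hs r
    rw [sum_pow_mul_eq_pow_mul_sum_zpow d e w hs.ne', mul_sub]
  change 0 < x₀ ^ e * c - ∑ k, x₀ ^ d k * w k at h0q
  change 0 < ∑ k, a ^ d k * w k - a ^ e * c at haq
  change 0 < ∑ k, b ^ d k * w k - b ^ e * c
  have h0' : ∑ k, x₀ ^ ((d k : ℤ) - e) * w k < c := by
    rw [sum_pow_mul_eq_pow_mul_sum_zpow d e w hx₀.ne', ← mul_sub] at h0q
    exact sub_pos.1 ((mul_pos_iff_of_pos_left (pow_pos hx₀ e)).1 h0q)
  have ha' : c < ∑ k, a ^ ((d k : ℤ) - e) * w k := by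
    rw [hg a ha] at haq
    exact sub_pos.1 ((mul_pos_iff_of_pos_left (pow_pos ha e)).1 haq)
  rw [hg b hb]
  refine mul_pos (pow_pos hb e) (sub_pos.2 ?_)
  -- convexity on [x₀, b] at the point a
  rcases eq_or_lt_of_le hab with hab' | hab'
  · rw [← hab']; exact ha'
  · have hx₀b : x₀ < b := lt_of_le_of_lt h₀a hab'
    have hden : 0 < b - x₀ := sub_pos.2 hx₀b
    set lam : ℝ := (b - a) / (b - x₀) with hlam
    set mu : ℝ := (a - x₀) / (b - x₀) with hmu
    have hlam0 : 0 ≤ lam := div_nonneg (sub_nonneg.2 hab) hden.le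
    have hlampos : 0 < lam := div_pos (sub_pos.2 hab') hden
    have hmu0 : 0 ≤ mu := div_nonneg (sub_nonneg.2 h₀a) hden.le
    have hsum : lam + mu = 1 := by
      rw [hlam, hmu, ← add_div, div_eq_one_iff_eq hden.ne']
      ring
    have haeq : lam • x₀ + mu • b = a := by
      rw [smul_eq_mul, smul_eq_mul, hlam, hmu]
      field_simp
      ring
    have conv := sum_zpow_mul_le_convex_comb (fun k => (d k : ℤ) - e) w hw0 hx₀ hb hlam0 hmu0 hsum
    rw [haeq] at conv
    -- if g(b) ≤ c then g(a) ≤ lam g(x₀) + mu g(b) < lam c + mu c = c, contradiction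
    by_contra hcon
    push Not at hcon
    have h1 : lam * ∑ k, x₀ ^ ((d k : ℤ) - e) * w k < lam * c := mul_lt_mul_of_pos_left h0' hlampos
    have h2 : mu * ∑ k, b ^ ((d k : ℤ) - e) * w k ≤ mu * c := mul_le_mul_of_nonneg_left hcon hmu0
    have h3 : lam * c + mu * c = c := by rw [← add_mul, hsum, one_mul]
    linarith

/-- **PSD-DOMINATION IS PERMANENT PAST A PIVOT-DOMINATED POINT (leftward, mirror).**  `0 < b ≤ a ≤ x₀`:
`x₀^e N − ∑ x₀^{dₖ}Pₖ ≻ 0` and `∑ a^{dₖ}Pₖ − a^e N ≻ 0` imply `∑ b^{dₖ}Pₖ − b^e N ≻ 0`. [folklore] -/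
theorem posDef_pencil_of_negDef_right (P : Fin K → Matrix (Fin m) (Fin m) ℝ) (hP : ∀ k, (P k).PosSemidef)
    (N : Matrix (Fin m) (Fin m) ℝ) (hN : N.IsSymm) (d : Fin K → ℕ) (e : ℕ) {x₀ a b : ℝ}
    (hb : 0 < b) (hba : b ≤ a) (ha₀ : a ≤ x₀)
    (hneg : (x₀ ^ e • N - ∑ k, x₀ ^ d k • P k).PosDef) (hFa : (∑ k, a ^ d k • P k - a ^ e • N).PosDef) :
    (∑ k, b ^ d k • P k - b ^ e • N).PosDef := by
  have ha : 0 < a := lt_of_lt_of_le hb hba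
  have hx₀ : 0 < x₀ := lt_of_lt_of_le ha ha₀
  have hherm : (∑ k, b ^ d k • P k - b ^ e • N).IsHermitian := by
    have h := isHermitian_pivotSub P (fun k => (hP k).1) N hN d e b
    rw [← neg_sub]
    exact h.neg
  refine PosDef.of_dotProduct_mulVec_pos hherm fun u hu => ?_
  have h0q := hneg.dotProduct_mulVec_pos hu
  have haq := hFa.dotProduct_mulVec_pos hu
  rw [star_trivial] at h0q haq ⊢
  rw [dotProduct_pivotSub_mulVec] at h0q
  rw [dotProduct_pencilSub_mulVec] at haq ⊢
  set c : ℝ := u ⬝ᵥ (N *ᵥ u) with hc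
  set w : Fin K → ℝ := fun k => u ⬝ᵥ (P k *ᵥ u) with hw
  have hw0 : ∀ k, 0 ≤ w k := fun k => by
    have h := (hP k).dotProduct_mulVec_nonneg u
    rwa [star_trivial] at h
  have hg : ∀ s : ℝ, 0 < s → ∀ r : ℝ, (∑ k, s ^ d k * w k - s ^ e * r = s ^ e * (∑ k, s ^ ((d k : ℤ) - e) * w k - r)) := by
    intro s hs r
    rw [sum_pow_mul_eq_pow_mul_sum_zpow d e w hs.ne', mul_sub]
  change 0 < x₀ ^ e * c - ∑ k, x₀ ^ d k * w k at h0q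
  change 0 < ∑ k, a ^ d k * w k - a ^ e * c at haq
  change 0 < ∑ k, b ^ d k * w k - b ^ e * c
  have h0' : ∑ k, x₀ ^ ((d k : ℤ) - e) * w k < c := by
    rw [sum_pow_mul_eq_pow_mul_sum_zpow d e w hx₀.ne', ← mul_sub] at h0q
    exact sub_pos.1 ((mul_pos_iff_of_pos_left (pow_pos hx₀ e)).1 h0q)
  have ha' : c < ∑ k, a ^ ((d k : ℤ) - e) * w k := by
    rw [hg a ha] at haq
    exact sub_pos.1 ((mul_pos_iff_of_pos_left (pow_pos ha e)).1 haq)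
  rw [hg b hb]
  refine mul_pos (pow_pos hb e) (sub_pos.2 ?_)
  rcases eq_or_lt_of_le hba with hba' | hba'
  · rw [hba']; exact ha'
  · have hbx₀ : b < x₀ := lt_of_lt_of_le hba' ha₀
    have hden : 0 < x₀ - b := sub_pos.2 hbx₀
    set lam : ℝ := (x₀ - a) / (x₀ - b) with hlam
    set mu : ℝ := (a - b) / (x₀ - b) with hmu
    have hlam0 : 0 ≤ lam := div_nonneg (sub_nonneg.2 ha₀) hden.le
    have hmu0 : 0 ≤ mu := div_nonneg (sub_nonneg.2 hba) hden.le
    have hmupos : 0 < mu := div_pos (sub_pos.2 hba') hden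
    have hsum : lam + mu = 1 := by
      rw [hlam, hmu, ← add_div, div_eq_one_iff_eq hden.ne']
      ring
    have haeq : lam • b + mu • x₀ = a := by
      rw [smul_eq_mul, smul_eq_mul, hlam, hmu]
      field_simp
      ring
    have conv := sum_zpow_mul_le_convex_comb (fun k => (d k : ℤ) - e) w hw0 hb hx₀ hlam0 hmu0 hsum
    rw [haeq] at conv
    by_contra hcon
    push Not at hcon
    have h1 : mu * ∑ k, x₀ ^ ((d k : ℤ) - e) * w k < mu * c := mul_lt_mul_of_pos_left h0' hmupos
    have h2 : lam * ∑ k, b ^ ((d k : ℤ) - e) * w k ≤ lam * c := mul_le_mul_of_nonneg_left hcon hlam0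
    have h3 : lam * c + mu * c = c := by rw [← add_mul, hsum, one_mul]
    linarith

end Summit.ValiantsHypothesis.ValiantsHypothesis.Theorems.KPlusLogSqLaw.DefinitePivot
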